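import Literature.NumberTheory.Sieve.IwaniecAlmostPrimesQuadraticRootsForms
import Literature.NumberTheory.Sieve.QuadraticRootsAllModuliPowerSavingProofs
import HarnessLib

/-!
# Iwaniec (1978) for a general quadratic: fundamental domains for the automorphs and the root-counting identity — PROVED

Continuation of `IwaniecAlmostPrimesQuadraticRootsForms.lean` (H. Iwaniec, Invent. Math. **47**
(1978) 171–188, Lemma 5 p. 178 for `n² + 1`, "the general case being similar", p. 172).  There
the roots `Θ` of `G(Θ) ≡ 0 (mod D)` (`G = aX² + bX + c`, `Δ = b² − 4ac` non-square, `a > 0`)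
were identified with `⊔_Φ AdmRep(Φ, aD)/Aut⁺(Φ)`, `Φ` over the class representatives
`posReps Δ`.  To turn sums over roots into sums over lattice points one needs, for each `Φ`, a
FUNDAMENTAL DOMAIN: a subgroup `U ≤ Aut⁺(Φ)` and a set `FD` of vectors meeting every `U`-orbit
of vectors `v` with `Φ(v) > 0` exactly once, with `FD ∩ {Φ = n}` finite (`IsFundDomain`).  This
file proves, for ANY such datum:

* `ncard_orbitFD_eq_nuFD` — every free `stab Φ`-orbit of coprime vectors of positive value
  meets `FD` in the same number `ν_Φ = nuFD Φ F ≥ 1` of points (the index of `U` in `stab Φ`,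
  never computed: two orbits are compared through the `stab Φ`-equivariant injection between
  them, using the freeness `RootForms.eq_one_of_vecAct_eq`; this is the `Set.ncard` form of the
  tree's `RootForms.card_orbit_inter_eq`, kept here in the shape the counting identity uses);
* `ncard_fibreSet` — hence the admissible representations of `aD` in `FD` with root `≡ Θ` number
  `ν_Φ` if `Ψ_Θ ~ Φ` and `0` otherwise;
* `sum_rootsG_eq_sum_posReps` — **the counting identity**: for `D ≥ 1` and `f` periodic mod `D`,
  `∑_{Θ mod D, G(Θ) ≡ 0} f(Θ) = ∑_{Φ ∈ posReps Δ} ν_Φ⁻¹ ∑_{v ∈ AdmRep(Φ, aD) ∩ FD_Φ} f(Θ_Φ(v))`,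
  the general form of "Lemma 5 as a change of variables in root sums"
  (`sum_rootsNat_eq_sum_gaussPairs` of the `n² + 1` files);

and assembles the standard data `stdFD Φ` (`isFundDomain_stdFD`) from the two fundamental
domains of the tree's Hooley-1963 files (`QuadraticRootsAllModuliPowerSavingProofs.lean`,
namespace `Hooley1963`): for `Δ < 0` the half plane `halfPlane` with `U = signedZpowers 1`
(`halfPlane_fund`), for `Δ > 0` the Pell sector `sector Φ e = {0 < ℓ₋ ≤ ℓ₊ < η² ℓ₋}` of a
positive Pell unit `e = stdPell Φ` with `U = signedZpowers (pellAut Φ e)` (`sector_fund`); the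
only thing added here is the finiteness of `FD ∩ {Φ = n}` (both coordinates are bounded on it).
In both cases `FD ⊆ {s ≥ 0}` and the only coprime `FD`-vector with `s = 0` is `(1, 0)`
(`snd_nonneg_of_mem_stdFD`, `eq_e₁_of_mem_stdFD`, from `Hooley1963.snd_nonneg_of_mem_sector`,
`Hooley1963.mem_sector_axis_iff`).

Relation to `Hooley1963.SliceData P h` (`QuadraticRootsAllModuliDomains.lean`): its fields
`G'`, `F`, `le_stab`, `fund` are exactly `U`, `FD`, `le_stab`, `existsUnique` below; `SliceData`
carries in addition the slice/twist bounds of the all-moduli estimate and no finiteness field.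
The counting identity of this file needs only the lighter `IsFundDomain` (plus finiteness), and
the exponential sums of the Iwaniec files need windows and congruence classes that `SliceData`
does not express, so the two structures are kept side by side.  Everything here is PROVED; no
named facts are introduced.

## References

* H. Iwaniec, Invent. Math. 47 (1978) 171–188, §4 Lemma 5, p. 179 (`IwaniecInventiones1978`).
* D. A. Cox, *Primes of the form x² + ny²*, 2nd ed. (2013), §2.A (`Cox2013`).
* C. Hooley, Acta Math. 117 (1967), §6 (30) (the fundamental domains, via the tree's
  `Hooley1963` files) (`Hooley1967`).
-/

namespace Literature.NumberTheory.Sieve.Iwaniec1978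

open Literature.NumberTheory.QuadraticFields.Quadratic
open Literature.NumberTheory.QuadraticFields.Quadratic.BinQF
open Literature.NumberTheory.Sieve.RootForms (smul smul_one smul_mul smul_mul_inv smul_inv_mul
  smul_a smul_disc vecAct vecAct_mul vecAct_one vecAct_e1 vecAct_neg eval_vecAct
  stab mem_stab_iff neg_one_mem_stab eval_vecAct_of_mem_stab signedZpowers mem_signedZpowers
  signedZpowers_le_stab)
open scoped MatrixGroups

/-! ### Fundamental domain data -/

/-- A candidate fundamental domain: a subgroup `U` of `SL₂(ℤ)` and a set of vectors. [folklore] -/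
structure FDData where
  /-- the subgroup of automorphs -/
  U : Subgroup SL(2, ℤ)
  /-- the domain -/
  FD : Set (ℤ × ℤ)

/-- `F` is a fundamental domain datum for `Φ`: `U ≤ Aut⁺(Φ)`, every `U`-orbit of vectors of
positive value meets `FD` exactly once, and `FD ∩ {Φ = n}` is finite. [folklore] -/
structure IsFundDomain (Φ : BinQF) (F : FDData) : Prop where
  le_stab : F.U ≤ stab Φ
  existsUnique : ∀ v : ℤ × ℤ, 0 < Φ.eval v.1 v.2 →
    ∃! w : ℤ × ℤ, w ∈ F.FD ∧ ∃ μ ∈ F.U, w = vecAct μ v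
  finite : ∀ n : ℤ, {v : ℤ × ℤ | v ∈ F.FD ∧ Φ.eval v.1 v.2 = n}.Finite

/-- `Φ(1, 0) = A`. [folklore] -/
theorem eval_e₁ (Φ : BinQF) : Φ.eval 1 0 = Φ.a := by
  simp [BinQF.eval]

/-- The part of the `Aut⁺(Φ)`-orbit of `v₀` inside `FD`. [folklore] -/
def orbitFD (Φ : BinQF) (F : FDData) (v₀ : ℤ × ℤ) : Set (ℤ × ℤ) :=
  {w | w ∈ F.FD ∧ ∃ σ ∈ stab Φ, w = vecAct σ v₀}

/-- `orbitFD` is finite. [folklore] -/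
theorem orbitFD_finite {Φ : BinQF} {F : FDData} (hF : IsFundDomain Φ F) (v₀ : ℤ × ℤ) :
    (orbitFD Φ F v₀).Finite :=
  (hF.finite (Φ.eval v₀.1 v₀.2)).subset (by
    rintro w ⟨hw, σ, hσ, rfl⟩
    exact ⟨hw, eval_vecAct_of_mem_stab hσ v₀⟩)

/-- Comparison of two orbits: `#(Aut⁺v₀ ∩ FD) ≤ #(Aut⁺v₁ ∩ FD)` for `v₀, v₁` of positive value,
`v₁` coprime (the map "`σv₀ ↦` the `FD`-point of `U σ v₁`" is injective by freeness).
[folklore] -/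
theorem ncard_orbitFD_le {Φ : BinQF} (hΦ : ¬ IsSquare Φ.disc) {F : FDData} (hF : IsFundDomain Φ F)
    {v₀ v₁ : ℤ × ℤ} (hp₀ : 0 < Φ.eval v₀.1 v₀.2) (h₁ : IsCoprime v₁.1 v₁.2)
    (hp₁ : 0 < Φ.eval v₁.1 v₁.2) :
    (orbitFD Φ F v₀).ncard ≤ (orbitFD Φ F v₁).ncard := by
  classical
  have key : ∀ w ∈ orbitFD Φ F v₀, ∃ σ : SL(2, ℤ), σ ∈ stab Φ ∧ w = vecAct σ v₀ :=
    fun w hw => by obtain ⟨σ, hσ, h⟩ := hw.2; exact ⟨σ, hσ, h⟩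
  choose! σf hσf hwσ using key
  have hβex : ∀ w ∈ orbitFD Φ F v₀,
      ∃! w', w' ∈ F.FD ∧ ∃ μ ∈ F.U, w' = vecAct μ (vecAct (σf w) v₁) :=
    fun w hw => hF.existsUnique _ (by rw [eval_vecAct_of_mem_stab (hσf w hw)]; exact hp₁)
  let β : ℤ × ℤ → ℤ × ℤ := fun w =>
    if hw : w ∈ orbitFD Φ F v₀ then (hβex w hw).exists.choose else w
  have hβ : ∀ w (hw : w ∈ orbitFD Φ F v₀),
      β w ∈ F.FD ∧ ∃ μ ∈ F.U, β w = vecAct μ (vecAct (σf w) v₁) := by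
    intro w hw
    simp only [β, hw, dif_pos]
    exact (hβex w hw).exists.choose_spec
  refine Set.ncard_le_ncard_of_injOn β ?_ ?_ (orbitFD_finite hF v₁)
  · intro w hw
    obtain ⟨hFD, μ, hμ, hβw⟩ := hβ w hw
    exact ⟨hFD, μ * σf w, (stab Φ).mul_mem (hF.le_stab hμ) (hσf w hw),
      by rw [hβw, vecAct_mul]⟩
  · intro w hw w' hw' heq
    obtain ⟨hFD, μ, hμ, hβw⟩ := hβ w hw
    obtain ⟨hFD', μ', hμ', hβw'⟩ := hβ w' hw'
    have hμA : μ ∈ stab Φ := hF.le_stab hμ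
    have hμ'A : μ' ∈ stab Φ := hF.le_stab hμ'
    -- `μ σ_w v₁ = μ' σ_{w'} v₁`, so `μ σ_w = μ' σ_{w'}` by freeness
    have hvec : vecAct (μ * σf w) v₁ = vecAct (μ' * σf w') v₁ := by
      rw [vecAct_mul, vecAct_mul, ← hβw, ← hβw', heq]
    have hone : (μ' * σf w')⁻¹ * (μ * σf w) = 1 := by
      refine eq_one_of_vecAct_eq' hΦ ?_ h₁ ?_
      · exact (stab Φ).mul_mem ((stab Φ).inv_mem ((stab Φ).mul_mem hμ'A (hσf w' hw')))
          ((stab Φ).mul_mem hμA (hσf w hw))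
      · rw [vecAct_mul, hvec, ← vecAct_mul, inv_mul_cancel, vecAct_one]
    have hστ : σf w' = μ'⁻¹ * μ * σf w := by
      have : μ * σf w = μ' * σf w' := by
        rw [← mul_right_inj ((μ' * σf w')⁻¹), hone, inv_mul_cancel]
      rw [mul_assoc, this, ← mul_assoc, inv_mul_cancel, one_mul]
    -- `w' = (μ'⁻¹ μ) w` with `μ'⁻¹ μ ∈ U`: uniqueness of the `FD`-point in `U·w`
    have hw'w : w' = vecAct (μ'⁻¹ * μ) w := by
      rw [hwσ w' hw', hστ, vecAct_mul, ← hwσ w hw]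
    have hpw : 0 < Φ.eval w.1 w.2 := by
      rw [hwσ w hw, eval_vecAct_of_mem_stab (hσf w hw)]; exact hp₀
    obtain ⟨w₀, -, huniq⟩ := hF.existsUnique w hpw
    have e1 : w = w₀ := huniq w ⟨hw.1, 1, F.U.one_mem, by rw [vecAct_one]⟩
    have e2 : w' = w₀ :=
      huniq w' ⟨hw'.1, μ'⁻¹ * μ, F.U.mul_mem (F.U.inv_mem hμ') hμ, hw'w⟩
    rw [e1, e2]

/-- `ν_Φ = #(Aut⁺e₁ ∩ FD)`, the number of `FD`-points in a free orbit of proper automorphs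
(`= [Aut⁺(Φ) : U]`). [folklore] -/
noncomputable def nuFD (Φ : BinQF) (F : FDData) : ℕ := (orbitFD Φ F (1, 0)).ncard

/-- `ν_Φ ≥ 1` when `A > 0`. [folklore] -/
theorem nuFD_pos {Φ : BinQF} {F : FDData} (hF : IsFundDomain Φ F) (hA : 0 < Φ.a) :
    0 < nuFD Φ F := by
  rw [nuFD, Set.ncard_pos (orbitFD_finite hF _)]
  obtain ⟨w, ⟨hw, μ, hμ, hwμ⟩, -⟩ := hF.existsUnique (1, 0) (by rw [eval_e₁]; exact hA)
  exact ⟨w, hw, μ, hF.le_stab hμ, hwμ⟩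

/-- **Every free orbit of positive value meets `FD` in exactly `ν_Φ` points.** [folklore] -/
theorem ncard_orbitFD_eq_nuFD {Φ : BinQF} (hΦ : ¬ IsSquare Φ.disc) {F : FDData}
    (hF : IsFundDomain Φ F) (hA : 0 < Φ.a) {v₀ : ℤ × ℤ} (h₀ : IsCoprime v₀.1 v₀.2)
    (hp₀ : 0 < Φ.eval v₀.1 v₀.2) : (orbitFD Φ F v₀).ncard = nuFD Φ F := by
  have hA' : 0 < Φ.eval (1 : ℤ) 0 := by rw [eval_e₁]; exact hA
  exact le_antisymm (ncard_orbitFD_le hΦ hF hp₀ isCoprime_one_left hA')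
    (ncard_orbitFD_le hΦ hF hA' h₀ hp₀)

/-! ### Fibres of `v ↦ Θ_Φ(v) mod D` inside `FD` -/

variable {a b c : ℤ}

/-- The admissible representations of `aD` by `Φ` in `FD` whose root is `≡ Θ (mod D)`.
[cite: IwaniecInventiones1978, Lemma 5] -/
def fibreSet (a b : ℤ) (Φ : BinQF) (F : FDData) (D : ℕ) (Θ : ℤ) : Set (ℤ × ℤ) :=
  {v | v ∈ F.FD ∧ IsAdmRep a b Φ (a * D) v ∧ thetaOf a b Φ v ≡ Θ [ZMOD D]}

/-- A nonempty fibre is the trace on `FD` of one `Aut⁺(Φ)`-orbit. [cite: IwaniecInventiones1978, Lemma 5] -/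
theorem fibreSet_eq_orbitFD (ha : a ≠ 0) {Φ : BinQF} (hΦ : Φ.disc = discrim a b c) (F : FDData)
    {D : ℕ} (hD0 : D ≠ 0) {Θ : ℤ} {v₀ : ℤ × ℤ} (hv₀ : IsAdmRep a b Φ (a * D) v₀)
    (hΘ : thetaOf a b Φ v₀ ≡ Θ [ZMOD D]) : fibreSet a b Φ F D Θ = orbitFD Φ F v₀ := by
  ext w
  constructor
  · rintro ⟨hw, hadm, hwΘ⟩
    obtain ⟨σ, hσ, hσw⟩ :=
      exists_mem_stab_of_thetaOf_modEq ha hΦ hD0 hv₀ hadm (hΘ.trans hwΘ.symm)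
    exact ⟨hw, σ, hσ, hσw.symm⟩
  · rintro ⟨hw, σ, hσ, rfl⟩
    obtain ⟨hadm, hmod⟩ := isAdmRep_vecAct ha hD0 hσ hv₀ hΦ
    exact ⟨hw, hadm, hmod.trans hΘ⟩

open scoped Classical in
/-- **The fibre count**: for a class representative `Φ`, a fundamental domain `F` and a root `Θ`
of `G` mod `D`, the admissible representations of `aD` in `FD` with root `≡ Θ` number `ν_Φ` if
`Ψ_Θ ~ Φ` and `0` otherwise. [cite: IwaniecInventiones1978, Lemma 5] -/
theorem ncard_fibreSet (ha : 0 < a) (hsq : ¬ IsSquare (discrim a b c)) {Φ : BinQF}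
    (hΦc : Φ ∈ posReps (discrim a b c)) {F : FDData} (hF : IsFundDomain Φ F) {D : ℕ}
    (hD : 0 < D) {Θ : ℤ} (hΘ : (D : ℤ) ∣ quadVal a b c Θ) :
    (fibreSet a b Φ F D Θ).ncard =
      if (thetaForm a b c D Θ).ProperEquiv Φ then nuFD Φ F else 0 := by
  classical
  obtain ⟨hΦd, hΦa⟩ := posForm_of_mem_posReps hΦc
  have hΦsq : ¬ IsSquare Φ.disc := by rwa [hΦd]
  split_ifs with h
  · obtain ⟨γ, hγ⟩ := properEquiv_iff_exists_smul.mp h.symm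
    obtain ⟨hadm, hmod⟩ := isAdmRep_of_smul_eq_thetaForm (b := b) (c := c) ha.ne' hγ.symm
    rw [fibreSet_eq_orbitFD ha.ne' hΦd F hD.ne' hadm hmod]
    refine ncard_orbitFD_eq_nuFD hΦsq hF hΦa (isCoprime_col γ) ?_
    simp only
    rw [hadm.eval_eq]
    exact mul_pos ha (by exact_mod_cast hD)
  · have hempty : fibreSet a b Φ F D Θ = ∅ := by
      ext v
      simp only [Set.mem_empty_iff_false, iff_false]
      rintro ⟨-, hadm, hvΘ⟩
      apply h
      have e₁ := properEquiv_thetaForm_thetaOf ha.ne' hΦd hD.ne' hadm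
      obtain ⟨t, ht⟩ := Int.modEq_iff_dvd.mp hvΘ.symm
      have hD0' : (D : ℤ) ≠ 0 := by exact_mod_cast hD.ne'
      have : thetaForm a b c D (thetaOf a b Φ v) = (thetaForm a b c D Θ).act 1 t 0 1 := by
        rw [← thetaForm_add_mul hD0' hΘ t]; congr 1; linear_combination ht
      rw [this] at e₁
      exact (show (thetaForm a b c D Θ).ProperEquiv ((thetaForm a b c D Θ).act 1 t 0 1) from
        ⟨1, t, 0, 1, by norm_num, rfl⟩).trans e₁.symm
    rw [hempty, Set.ncard_empty]

/-! ### The counting identity -/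

/-- The roots of `G` modulo `D` as natural numbers `0 ≤ Θ < D` (so that
`#rootsG a b c D = polyRootCountMod ![G] D = ρ_G(D)`). [cite: IwaniecInventiones1978, §1 p. 171] -/
def rootsG (a b c : ℤ) (D : ℕ) : Finset ℕ :=
  (Finset.range D).filter (fun Θ : ℕ => (D : ℤ) ∣ quadVal a b c Θ)

/-- Membership in `rootsG`. [folklore] -/
theorem mem_rootsG {D Θ : ℕ} : Θ ∈ rootsG a b c D ↔ Θ < D ∧ (D : ℤ) ∣ quadVal a b c Θ := by
  simp [rootsG]

open scoped Classical in
/-- The admissible representations of `aD` by `Φ` lying in `FD` (a finite set; `∅` as a junk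
value if `FD ∩ {Φ = aD}` were infinite). [cite: IwaniecInventiones1978, Lemma 5] -/
noncomputable def admRepsFD (a b : ℤ) (Φ : BinQF) (F : FDData) (D : ℕ) : Finset (ℤ × ℤ) :=
  if h : {v : ℤ × ℤ | v ∈ F.FD ∧ Φ.eval v.1 v.2 = a * D}.Finite then
    h.toFinset.filter (fun v => IsAdmRep a b Φ (a * D) v)
  else ∅

/-- Membership in `admRepsFD`. [folklore] -/
theorem mem_admRepsFD {Φ : BinQF} {F : FDData} (hF : IsFundDomain Φ F) {D : ℕ} {v : ℤ × ℤ} :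
    v ∈ admRepsFD a b Φ F D ↔ v ∈ F.FD ∧ IsAdmRep a b Φ (a * D) v := by
  classical
  rw [admRepsFD, dif_pos (hF.finite _), Finset.mem_filter, Set.Finite.mem_toFinset]
  simp only [Set.mem_setOf_eq]
  constructor
  · rintro ⟨⟨h1, -⟩, h2⟩; exact ⟨h1, h2⟩
  · rintro ⟨h1, h2⟩; exact ⟨⟨h1, h2.eval_eq⟩, h2⟩

/-- `D ∣ G(x)` depends only on `x mod D`. [folklore] -/
theorem dvd_quadVal_of_modEq {D : ℕ} {x y : ℤ} (h : x ≡ y [ZMOD D])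
    (hx : (D : ℤ) ∣ quadVal a b c x) : (D : ℤ) ∣ quadVal a b c y := by
  rw [← ZMod.intCast_zmod_eq_zero_iff_dvd] at hx ⊢
  have h' := (ZMod.intCast_eq_intCast_iff x y D).mpr h
  simp only [quadVal, Int.cast_add, Int.cast_mul, Int.cast_pow] at hx ⊢
  rw [← h']
  exact hx

/-- The reduction of `Θ_Φ(v)` modulo `D` lies in `rootsG` for an admissible `v`. [folklore] -/
theorem toNat_thetaOf_mem_rootsG (ha : a ≠ 0) {Φ : BinQF} (hΦ : Φ.disc = discrim a b c) {D : ℕ}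
    (hD : 0 < D) {v : ℤ × ℤ} (hv : IsAdmRep a b Φ (a * D) v) :
    (thetaOf a b Φ v % D).toNat ∈ rootsG a b c D ∧
      thetaOf a b Φ v ≡ ((thetaOf a b Φ v % D).toNat : ℕ) [ZMOD D] := by
  have hD0 : (D : ℤ) ≠ 0 := by exact_mod_cast hD.ne'
  have h0 : 0 ≤ thetaOf a b Φ v % D := Int.emod_nonneg _ hD0
  have hcast : (((thetaOf a b Φ v % D).toNat : ℕ) : ℤ) = thetaOf a b Φ v % D :=
    Int.toNat_of_nonneg h0
  have hmod : thetaOf a b Φ v ≡ ((thetaOf a b Φ v % D).toNat : ℕ) [ZMOD D] := by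
    rw [hcast]; exact (Int.emod_emod_of_dvd _ dvd_rfl).symm
  refine ⟨mem_rootsG.mpr ⟨?_, ?_⟩, hmod⟩
  · have : thetaOf a b Φ v % D < D := Int.emod_lt_of_pos _ (by exact_mod_cast hD)
    omega
  · exact dvd_quadVal_of_modEq hmod (dvd_quad_thetaOf ha hΦ hD.ne' hv)

/-- **The counting identity (general Lemma 5 as a change of variables in root sums).**  For
`a > 0`, `Δ = b² − 4ac` not a square, fundamental domains `F Φ` for the class representatives,
`D ≥ 1` and `f` periodic modulo `D`:
`∑_{Θ ∈ rootsG D} f(Θ) = ∑_{Φ ∈ posReps Δ} ν_Φ⁻¹ ∑_{v ∈ AdmRep(Φ, aD) ∩ FD_Φ} f(Θ_Φ(v))`.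
[cite: IwaniecInventiones1978, Lemma 5] -/
theorem sum_rootsG_eq_sum_posReps (ha : 0 < a) (hsq : ¬ IsSquare (discrim a b c))
    {F : BinQF → FDData} (hF : ∀ Φ ∈ posReps (discrim a b c), IsFundDomain Φ (F Φ))
    {D : ℕ} (hD : 0 < D) (f : ℤ → ℂ) (hf : ∀ x y : ℤ, x ≡ y [ZMOD D] → f x = f y) :
    ∑ Θ ∈ rootsG a b c D, f Θ =
      ∑ Φ ∈ posReps (discrim a b c),
        ((nuFD Φ (F Φ) : ℂ))⁻¹ * ∑ v ∈ admRepsFD a b Φ (F Φ) D, f (thetaOf a b Φ v) := by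
  classical
  -- Step 1: each inner sum fibrewise over the root `Θ = Θ_Φ(v) mod D`
  have hinner : ∀ Φ ∈ posReps (discrim a b c),
      ∑ v ∈ admRepsFD a b Φ (F Φ) D, f (thetaOf a b Φ v) =
        ∑ Θ ∈ rootsG a b c D,
          f Θ * (if (thetaForm a b c D Θ).ProperEquiv Φ then (nuFD Φ (F Φ) : ℂ) else 0) := by
    intro Φ hΦc
    obtain ⟨hΦd, hΦa⟩ := posForm_of_mem_posReps hΦc
    set g : ℤ × ℤ → ℕ := fun v => (thetaOf a b Φ v % D).toNat with hg
    have hmaps : ∀ v ∈ admRepsFD a b Φ (F Φ) D, g v ∈ rootsG a b c D := fun v hv =>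
      (toNat_thetaOf_mem_rootsG ha.ne' hΦd hD ((mem_admRepsFD (hF Φ hΦc)).mp hv).2).1
    rw [← Finset.sum_fiberwise_of_maps_to hmaps]
    refine Finset.sum_congr rfl fun Θ hΘ => ?_
    obtain ⟨hΘD, hΘroot⟩ := mem_rootsG.mp hΘ
    -- on the fibre, `f(Θ_Φ(v)) = f(Θ)`; the fibre is `fibreSet`
    have hfib : ∀ v ∈ (admRepsFD a b Φ (F Φ) D).filter (fun v => g v = Θ),
        f (thetaOf a b Φ v) = f Θ := by
      intro v hv
      rw [Finset.mem_filter] at hv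
      obtain ⟨hv, hgv⟩ := hv
      have := (toNat_thetaOf_mem_rootsG ha.ne' hΦd hD ((mem_admRepsFD (hF Φ hΦc)).mp hv).2).2
      rw [show g v = (thetaOf a b Φ v % D).toNat from rfl] at hgv
      rw [hgv] at this
      exact hf _ _ this
    rw [Finset.sum_congr rfl hfib, Finset.sum_const, nsmul_eq_mul, mul_comm]
    congr 1
    -- the cardinality of the fibre
    have hset : ((admRepsFD a b Φ (F Φ) D).filter (fun v => g v = Θ) : Set (ℤ × ℤ)) =
        fibreSet a b Φ (F Φ) D Θ := by
      ext v
      simp only [Finset.coe_filter, Set.mem_setOf_eq, fibreSet, mem_admRepsFD (hF Φ hΦc)]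
      constructor
      · rintro ⟨⟨hFD, hadm⟩, hgv⟩
        refine ⟨hFD, hadm, ?_⟩
        have := (toNat_thetaOf_mem_rootsG ha.ne' hΦd hD hadm).2
        rw [show (thetaOf a b Φ v % D).toNat = g v from rfl, hgv] at this
        exact this
      · rintro ⟨hFD, hadm, hvΘ⟩
        refine ⟨⟨hFD, hadm⟩, ?_⟩
        show (thetaOf a b Φ v % D).toNat = Θ
        have h1 : thetaOf a b Φ v % D = (Θ : ℤ) % D := hvΘ
        rw [h1, Int.emod_eq_of_lt (by positivity) (by exact_mod_cast hΘD), Int.toNat_natCast]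
    have hcard := ncard_fibreSet ha hsq hΦc (hF Φ hΦc) hD hΘroot
    rw [← hset, Set.ncard_coe_finset] at hcard
    rw [hcard]
    push_cast
    rfl
  rw [show (∑ Φ ∈ posReps (discrim a b c), ((nuFD Φ (F Φ) : ℂ))⁻¹ *
      ∑ v ∈ admRepsFD a b Φ (F Φ) D, f (thetaOf a b Φ v)) =
      ∑ Φ ∈ posReps (discrim a b c), ((nuFD Φ (F Φ) : ℂ))⁻¹ * ∑ Θ ∈ rootsG a b c D,
        f Θ * (if (thetaForm a b c D Θ).ProperEquiv Φ then (nuFD Φ (F Φ) : ℂ) else 0) from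
    Finset.sum_congr rfl fun Φ hΦ => by rw [hinner Φ hΦ]]
  -- Step 2: swap the sums and use `ν_Φ⁻¹ ν_Φ = 1`, then count the classes of `Ψ_Θ`
  simp_rw [Finset.mul_sum]
  rw [Finset.sum_comm]
  refine Finset.sum_congr rfl fun Θ hΘ => ?_
  obtain ⟨-, hΘroot⟩ := mem_rootsG.mp hΘ
  have hterm : ∀ Φ ∈ posReps (discrim a b c),
      ((nuFD Φ (F Φ) : ℂ))⁻¹ *
          (f Θ * (if (thetaForm a b c D Θ).ProperEquiv Φ then (nuFD Φ (F Φ) : ℂ) else 0)) =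
        f Θ * (if (thetaForm a b c D Θ).ProperEquiv Φ then 1 else 0) := by
    intro Φ hΦc
    have hν : (nuFD Φ (F Φ) : ℂ) ≠ 0 := by
      exact_mod_cast (nuFD_pos (hF Φ hΦc) (posForm_of_mem_posReps hΦc).2).ne'
    split_ifs
    · field_simp
    · simp
  rw [Finset.sum_congr rfl hterm, ← Finset.mul_sum]
  suffices hS : ∑ Φ ∈ posReps (discrim a b c),
      (if (thetaForm a b c D Θ).ProperEquiv Φ then (1 : ℂ) else 0) = 1 by rw [hS, mul_one]
  rw [← Finset.sum_filter, Finset.sum_const, nsmul_eq_mul, mul_one]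
  have hone : ((posReps (discrim a b c)).filter
      (fun Φ => (thetaForm a b c D Θ).ProperEquiv Φ)).card = 1 := by
    obtain ⟨Φ₀, ⟨hΦ₀, he₀⟩, huniq⟩ :=
      existsUnique_mem_posReps_properEquiv hsq (posForm_thetaForm ha hD hΘroot)
    rw [Finset.card_eq_one]
    refine ⟨Φ₀, Finset.eq_singleton_iff_unique_mem.mpr ⟨Finset.mem_filter.mpr ⟨hΦ₀, he₀⟩, ?_⟩⟩
    intro Φ hΦ
    rw [Finset.mem_filter] at hΦ
    exact huniq Φ ⟨hΦ.1, hΦ.2⟩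
  rw [hone]
  simp


/-! ### The two standard data: the half-plane and the Pell sector of `Hooley1963` -/

/-- The definite datum `({±1}, half plane)`: `U = signedZpowers 1`, `FD = Hooley1963.halfPlane`
(`{s > 0} ∪ {s = 0, u > 0}`). [cite: Hooley1967, §6 (30)] -/
def negFDData : FDData := ⟨signedZpowers 1, Hooley1963.halfPlane⟩

/-- For a positive definite form the definite datum is a fundamental domain (existence and
uniqueness: `Hooley1963.halfPlane_fund`; finiteness: `|s| ≤ 4An`, `|u| ≤ 4Cn`).
[cite: Cox2013, §2.A] -/
theorem isFundDomain_negFDData {Φ : BinQF} (hΔ : Φ.disc < 0) (hA : 0 < Φ.a) :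
    IsFundDomain Φ negFDData where
  le_stab := signedZpowers_le_stab (stab Φ).one_mem
  existsUnique := fun v hv => Hooley1963.halfPlane_fund Φ v hv
  finite := by
    intro n
    have hC : 0 < Φ.c := by
      have : Φ.b ^ 2 - 4 * Φ.a * Φ.c < 0 := hΔ
      nlinarith [sq_nonneg Φ.b]
    set K : ℤ := 4 * (Φ.a + Φ.c) * |n| with hK
    refine (Finset.finite_toSet (Finset.Icc (-K) K ×ˢ Finset.Icc (-K) K)).subset ?_
    rintro ⟨u, s⟩ ⟨-, hn⟩
    simp only [BinQF.eval] at hn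
    simp only [Finset.coe_product, Finset.coe_Icc, Set.mem_prod, Set.mem_Icc]
    have hΔ' : Φ.b ^ 2 - 4 * Φ.a * Φ.c ≤ -1 := by have : Φ.b ^ 2 - 4 * Φ.a * Φ.c < 0 := hΔ; omega
    have h1 : 4 * Φ.a * n = (2 * Φ.a * u + Φ.b * s) ^ 2 - (Φ.b ^ 2 - 4 * Φ.a * Φ.c) * s ^ 2 := by
      rw [← hn]; ring
    have h2 : 4 * Φ.c * n = (2 * Φ.c * s + Φ.b * u) ^ 2 - (Φ.b ^ 2 - 4 * Φ.a * Φ.c) * u ^ 2 := by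
      rw [← hn]; ring
    have hs2 : s ^ 2 ≤ 4 * Φ.a * n := by nlinarith [sq_nonneg (2 * Φ.a * u + Φ.b * s), sq_nonneg s]
    have hu2 : u ^ 2 ≤ 4 * Φ.c * n := by nlinarith [sq_nonneg (2 * Φ.c * s + Φ.b * u), sq_nonneg u]
    have hs : |s| ≤ K := by
      have h3 : |s| ≤ s ^ 2 := by rw [← sq_abs]; nlinarith [abs_nonneg s]
      have : 4 * Φ.a * n ≤ K := by rw [hK]; nlinarith [le_abs_self n, abs_nonneg n]
      linarith
    have hu : |u| ≤ K := by
      have h3 : |u| ≤ u ^ 2 := by rw [← sq_abs]; nlinarith [abs_nonneg u]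
      have : 4 * Φ.c * n ≤ K := by rw [hK]; nlinarith [le_abs_self n, abs_nonneg n]
      linarith
    exact ⟨abs_le.mp hu, abs_le.mp hs⟩

/-- The indefinite datum attached to a positive Pell unit `e`: `U = signedZpowers (pellAut Φ e)`,
`FD = Hooley1963.sector Φ e = {0 < ℓ₋ ≤ ℓ₊ < η² ℓ₋}`. [cite: Hooley1967, §6 (30)] -/
def posFDData (Φ : BinQF) (e : Hooley1963.PosPell Φ.disc) : FDData :=
  ⟨signedZpowers (Hooley1963.pellAut Φ e), Hooley1963.sector Φ e⟩

/-- For an indefinite form of non-square discriminant with `A > 0`, the indefinite datum is a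
fundamental domain (existence and uniqueness: `Hooley1963.sector_fund`; finiteness: on the sector
`ℓ₋² ≤ ℓ₊ℓ₋ = 4An` and `ℓ₊ < η² ℓ₋` bound both coordinates). [cite: Cox2013, §2.A] -/
theorem isFundDomain_posFDData {Φ : BinQF} (hΔ : 0 < Φ.disc) (hA : 0 < Φ.a)
    (e : Hooley1963.PosPell Φ.disc) : IsFundDomain Φ (posFDData Φ e) where
  le_stab := signedZpowers_le_stab (Hooley1963.pellAut_mem_stab Φ e)
  existsUnique := fun v hv => Hooley1963.sector_fund hA hΔ e v hv
  finite := by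
    intro n
    have hη1 := Hooley1963.one_lt_eta hΔ e
    have hη0 : 0 < Hooley1963.eta Φ e := zero_lt_one.trans hη1
    have hrt : 0 < Hooley1963.rt Φ := Hooley1963.rt_pos hΔ
    have hA' : (0 : ℝ) < Φ.a := by exact_mod_cast hA
    set η := Hooley1963.eta Φ e with hηdef
    set ρ := Hooley1963.rt Φ with hρdef
    -- bounds: `ℓ₋ ≤ R := √(4A|n|) + 1`, `ℓ₊ < η² R`
    set R : ℝ := Real.sqrt (4 * Φ.a * |(n : ℝ)|) + 1 with hR
    have hR0 : 0 < R := by positivity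
    set K : ℝ := (η ^ 2 * R + R) / (2 * ρ) + (η ^ 2 * R + R) / (2 * Φ.a) +
      |(Φ.b : ℝ)| * ((η ^ 2 * R + R) / (2 * ρ)) / (2 * Φ.a) with hK
    refine (Finset.finite_toSet (Finset.Icc (-⌈K⌉) ⌈K⌉ ×ˢ Finset.Icc (-⌈K⌉) ⌈K⌉)).subset ?_
    rintro ⟨u, s⟩ ⟨⟨h1, h2, h3⟩, hn⟩
    simp only [Finset.coe_product, Finset.coe_Icc, Set.mem_prod, Set.mem_Icc]
    have hLL' := Hooley1963.ellP_mul_ellM hΔ (u, s)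
    simp only at hLL' hn h1 h2 h3
    rw [hn] at hLL'
    set L := Hooley1963.ellP Φ (u, s) with hLdef
    set L' := Hooley1963.ellM Φ (u, s) with hL'def
    have hL'R : L' ≤ R := by
      have : L' ^ 2 ≤ 4 * Φ.a * |(n : ℝ)| := by
        calc L' ^ 2 = L' * L' := sq L'
          _ ≤ L * L' := mul_le_mul_of_nonneg_right h2 h1.le
          _ = 4 * Φ.a * (n : ℝ) := hLL'
          _ ≤ 4 * Φ.a * |(n : ℝ)| := by
              apply mul_le_mul_of_nonneg_left (le_abs_self _) (by positivity)
      have := Real.le_sqrt (h1.le) (by positivity) |>.mpr this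
      rw [hR]; linarith
    have hLR : L ≤ η ^ 2 * R := by
      have := mul_le_mul_of_nonneg_left hL'R (by positivity : (0 : ℝ) ≤ η ^ 2)
      linarith
    have hs_eq : (s : ℝ) = (L - L') / (2 * ρ) := by
      rw [hLdef, hL'def]; simp only [Hooley1963.ellP, Hooley1963.ellM]; field_simp; ring
    have hu_eq : (u : ℝ) = ((L + L') / 2 - Φ.b * s) / (2 * Φ.a) := by
      rw [hLdef, hL'def]; simp only [Hooley1963.ellP, Hooley1963.ellM]; field_simp; ring
    have hs0 : (0 : ℝ) ≤ s := by rw [hs_eq]; apply div_nonneg (by linarith) (by positivity)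
    have hsK : (s : ℝ) ≤ (η ^ 2 * R + R) / (2 * ρ) := by
      rw [hs_eq]; apply div_le_div_of_nonneg_right _ (by positivity); linarith
    have hL0 : 0 ≤ L := h1.le.trans h2
    have huK : |(u : ℝ)| ≤ (η ^ 2 * R + R) / (2 * Φ.a) +
        |(Φ.b : ℝ)| * ((η ^ 2 * R + R) / (2 * ρ)) / (2 * Φ.a) := by
      rw [hu_eq, abs_div, abs_of_pos (by positivity : (0:ℝ) < 2 * Φ.a), ← add_div]
      apply div_le_div_of_nonneg_right _ (by positivity)
      calc |(L + L') / 2 - Φ.b * s| ≤ |(L + L') / 2| + |(Φ.b : ℝ) * s| := abs_sub _ _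
        _ = (L + L') / 2 + |(Φ.b : ℝ)| * s := by
            rw [abs_of_nonneg (by linarith), abs_mul, abs_of_nonneg hs0]
        _ ≤ (η ^ 2 * R + R) + |(Φ.b : ℝ)| * ((η ^ 2 * R + R) / (2 * ρ)) := by
            have := mul_le_mul_of_nonneg_left hsK (abs_nonneg (Φ.b : ℝ))
            linarith
    have hsK' : |(s : ℝ)| ≤ K := by
      rw [abs_of_nonneg hs0, hK]
      have : 0 ≤ (η ^ 2 * R + R) / (2 * Φ.a) +
          |(Φ.b : ℝ)| * ((η ^ 2 * R + R) / (2 * ρ)) / (2 * Φ.a) := by positivity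
      linarith
    have huK' : |(u : ℝ)| ≤ K := by
      rw [hK]
      have : 0 ≤ (η ^ 2 * R + R) / (2 * ρ) := by positivity
      linarith
    have hceil : ∀ z : ℤ, |(z : ℝ)| ≤ K → -⌈K⌉ ≤ z ∧ z ≤ ⌈K⌉ := by
      intro z hz
      rw [abs_le] at hz
      have hK' : K ≤ (⌈K⌉ : ℝ) := Int.le_ceil K
      have h1 : ((-z : ℤ) : ℝ) ≤ (⌈K⌉ : ℝ) := by push_cast; linarith
      have h2 : ((z : ℤ) : ℝ) ≤ (⌈K⌉ : ℝ) := by linarith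
      have h1' : -z ≤ ⌈K⌉ := by exact_mod_cast h1
      have h2' : z ≤ ⌈K⌉ := by exact_mod_cast h2
      omega
    exact ⟨hceil u huK', hceil s hsK'⟩

/-! ### The standard fundamental domain and its elementary geometry -/

/-- The positive Pell unit used for an indefinite form (a choice from `Hooley1963.nonempty_posPell`).
[folklore] -/
noncomputable def stdPell (Φ : BinQF) (h : 0 < Φ.disc ∧ ¬ IsSquare Φ.disc) : Hooley1963.PosPell Φ.disc :=
  Classical.choice (Hooley1963.nonempty_posPell h.1 h.2)

/-- The standard datum: the half plane for `Δ < 0`, the Pell sector of `stdPell Φ` for `Δ > 0`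
non-square (and an irrelevant junk value otherwise). [folklore] -/
noncomputable def stdFD (Φ : BinQF) : FDData :=
  if Φ.disc < 0 then negFDData
  else if h : 0 < Φ.disc ∧ ¬ IsSquare Φ.disc then posFDData Φ (stdPell Φ h) else ⟨⊥, ∅⟩

/-- For `Δ > 0` non-square, `stdFD Φ` is the sector datum of `stdPell Φ`. [folklore] -/
theorem stdFD_of_pos {Φ : BinQF} (hΔ : 0 < Φ.disc) (hsq : ¬ IsSquare Φ.disc) :
    stdFD Φ = posFDData Φ (stdPell Φ ⟨hΔ, hsq⟩) := by
  rw [stdFD, if_neg (by omega), dif_pos ⟨hΔ, hsq⟩]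

/-- For `Δ < 0`, `stdFD Φ` is the half-plane datum. [folklore] -/
theorem stdFD_of_neg {Φ : BinQF} (hΔ : Φ.disc < 0) : stdFD Φ = negFDData := by
  rw [stdFD, if_pos hΔ]

/-- A non-square discriminant is `< 0` or `> 0`. [folklore] -/
theorem disc_neg_or_pos {Φ : BinQF} (hsq : ¬ IsSquare Φ.disc) : Φ.disc < 0 ∨ 0 < Φ.disc := by
  have h0 : Φ.disc ≠ 0 := fun h0 => hsq ⟨0, by rw [h0, mul_zero]⟩
  omega

/-- **`stdFD Φ` is a fundamental domain** for every form of non-square discriminant with `A > 0`.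
[cite: Cox2013, §2.A] -/
theorem isFundDomain_stdFD {Φ : BinQF} (hsq : ¬ IsSquare Φ.disc) (hA : 0 < Φ.a) :
    IsFundDomain Φ (stdFD Φ) := by
  rcases disc_neg_or_pos hsq with h | h
  · rw [stdFD_of_neg h]; exact isFundDomain_negFDData h hA
  · rw [stdFD_of_pos h hsq]; exact isFundDomain_posFDData h hA _

/-- Vectors of the standard domain have `s ≥ 0` (`Hooley1963.snd_nonneg_of_mem_sector`).
[folklore] -/
theorem snd_nonneg_of_mem_stdFD {Φ : BinQF} (hsq : ¬ IsSquare Φ.disc) {v : ℤ × ℤ}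
    (hv : v ∈ (stdFD Φ).FD) : 0 ≤ v.2 := by
  rcases disc_neg_or_pos hsq with h | h
  · rw [stdFD_of_neg h] at hv
    rcases hv with h1 | ⟨h1, -⟩ <;> omega
  · rw [stdFD_of_pos h hsq] at hv
    exact Hooley1963.snd_nonneg_of_mem_sector h hv

/-- The only coprime vector of the standard domain with `s = 0` is `e₁ = (1, 0)`
(`Hooley1963.mem_sector_axis_iff`). [folklore] -/
theorem eq_e₁_of_mem_stdFD {Φ : BinQF} (hsq : ¬ IsSquare Φ.disc) (hA : 0 < Φ.a) {v : ℤ × ℤ}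
    (hv : v ∈ (stdFD Φ).FD) (hs : v.2 = 0) (hcop : IsCoprime v.1 v.2) : v = (1, 0) := by
  have hu : v.1 = 1 ∨ v.1 = -1 := by
    rw [hs, isCoprime_zero_right, Int.isUnit_iff] at hcop; exact hcop
  have hpos : 0 < v.1 := by
    rcases disc_neg_or_pos hsq with h | h
    · rw [stdFD_of_neg h] at hv
      rcases hv with h1 | ⟨-, h1⟩ <;> omega
    · rw [stdFD_of_pos h hsq] at hv
      have hv' : ((v.1, (0 : ℤ)) : ℤ × ℤ) ∈ Hooley1963.sector Φ (stdPell Φ ⟨h, hsq⟩) := by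
        have : v = (v.1, (0 : ℤ)) := Prod.ext rfl hs
        rw [this] at hv; exact hv
      exact (Hooley1963.mem_sector_axis_iff hA h _ v.1).mp hv'
  rcases hu with h | h
  · exact Prod.ext h hs
  · omega

end Literature.NumberTheory.Sieve.Iwaniec1978
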